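import Literature.Topology.FourManifolds.BandSumConcordanceNormal
import Literature.Topology.FourManifolds.BandSumInTubeRegular
import Literature.Topology.FourManifolds.SchubertRegular
import Literature.Topology.FourManifolds.BandSumIsotopyRegularProofs
import HarnessLib

/-!
# Concordance of connected sums, regular normal position: the connected sum of concordances
# from the printed form of Schubert's theorem

Topic `Literature/Topology/FourManifolds`; sequel of `BandSumConcordanceNormal.lean` and
`BandSumInTubeRegular.lean` in the proof programme of the named fact
`Literature.Topology.FourManifolds.Knot.exists_isConnectedSum_isConcordant`
(`BandSumConcordance.lean`; Fox–Milnor (1966), §1; Livingston (2005), Thm. 2.2).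
`BandSumConcordanceNormal.lean` reduced the fact to Schubert's theorem in normal position for the
tree's corner-free band data (`Knot.Schubert1949_normalPosition`), whereas the form of Schubert's
theorem that is printed and being decomposed is the one for **regular** presentations
(`Knot.Schubert1949_normalPosition_regular`, `SchubertRegular.lean`; its one remaining unproved
input is the heart `Knot.Schubert1949_normalPosition_rebuilt` of `SchubertNormalForm.lean`, the
printed band fact `BandData.isIsotopic_of_band_eq_of_isRegular` being proved in
`BandSumIsotopyRegularProofs.lean`). Using the regular (collar-shrunk) band-sum data of the carrying
construction (`KnotPiece.InTube.bandDataₛ`, `isRegular_bandDataₛ`, `BandSumInTubeRegular.lean`),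
this file puts the fact on that route. Everything here is proved:

* `KnotPiece.InTube.exists_isRegularNormalConnectedSum_of_transport` — transport to normal position
  with a *regular* normal presentation (`Knot.IsRegularNormalConnectedSum`; same proof as
  `exists_isNormalConnectedSum_of_transport`, transporting `bandDataₛ` instead of `bandData`;
  regularity is preserved by diffeomorphisms, `BandData.IsRegular.of_band_eq_comp`);
* `IsConicalConcordance.exists_isRegularNormalConnectedSum_isConcordant_of_model`,
  `IsConicalConcordance.exists_isRegularNormalConnectedSum_isConcordant` — the carrying
  construction with regular normally presented ends (same choices as in
  `BandSumConcordanceLeftProofs.lean`);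
* `Knot.IsRegularNormalConnectedSum.isNormalConnectedSum/of_isIsotopic/swap`,
  `BandData.IsRegular.of_band_eq_halfTurn` (regularity survives the half-turn of the square),
  `Knot.exists_isRegularNormalConnectedSum_isConcordant_left/right`,
  `Knot.IsRegularNormalConnectedSum.isIsotopic_of_normalPosition_regular`;
* **`Knot.exists_isConnectedSum_isConcordant_of_normalPosition_regular`** — the named fact from
  `Schubert1949_normalPosition_regular` alone, and
  **`Knot.exists_isConnectedSum_isConcordant_of_rebuilt`** — from
  `Knot.Schubert1949_normalPosition_rebuilt` ALONE, the printed band fact being proved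
  (`BandData.isIsotopic_of_band_eq_of_isRegular_holds`, `BandSumIsotopyRegularProofs.lean`): the
  upstream set of the fact is {`Knot.Schubert1949_normalPosition_rebuilt`} (equivalently, via
  `…_of_normalPosition_regular`, {`Knot.Schubert1949_normalPosition_regular`}). (An earlier
  reduction of this file to a 2-dimensional two-arc lemma together with the rebuilt heart has been
  retired with that lemma, which the lifted-arc proof of the band fact made unnecessary.)

## References

* R. H. Fox, J. W. Milnor, *Singularities of 2-spheres in 4-space and cobordism of knots*, Osaka
  J. Math. 3 (1966), 257–267, §1. [FoxMilnor1966]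
* C. Livingston, *A survey of classical knot concordance*, Handbook of Knot Theory (2005), §2.1,
  Thm. 2.2. [Livingston2005]
* P. R. Cromwell, *Knots and Links* (2004), §4.6 (products along an embedded rectangle, in normal
  position). [Cromwell2004]

## Design notes

No statement of another file is modified; no named fact; no `sorry`; no local notation. The
first three proofs repeat those of `BandSumConcordanceNormal.lean` up to the band data used and
the regularity threaded through (the tree is append-only and the landed theorems export weaker
conclusions).
-/

open Set Function Metric
open scoped Topology ContDiff Manifold RealInnerProductSpace

noncomputable section

namespace Literature.Topology.FourManifolds

/-! ### Regularity survives the half-turn of the band square -/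

namespace BandData

variable {K₁ K₂ K K₁' K₂' K' : Knot}
  {avoid avoid' : Set (sphere (0 : EuclideanSpace ℝ (Fin 4)) 1)}

/-- **Regularity is preserved by the half-turn of the square**: if `b'` has band
`x ↦ b.band ((1, 1) - x)` and the same collar width as the regular `b`, then `b'` is regular
(the half-turn maps every collar square onto itself and is an affine isomorphism). [folklore] -/
theorem IsRegular.of_band_eq_halfTurn {b : BandData K₁ K₂ K avoid} {b' : BandData K₁' K₂' K' avoid'}
    (h : b.IsRegular) (hband : b'.band = fun x ↦ b.band (pt2 1 1 - x)) (hδ : b'.δ = b.δ) :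
    b'.IsRegular := by
  obtain ⟨δ₀, hδ₀, hinj, himm⟩ := h
  have hρs : ContDiff ℝ ∞ (fun x : EuclideanSpace ℝ (Fin 2) ↦ pt2 1 1 - x) :=
    contDiff_const.sub contDiff_id
  refine ⟨δ₀, hδ ▸ hδ₀, ?_, fun x hx ↦ ?_⟩
  · rw [hband]
    exact fun x hx y hy hxy ↦ sub_right_injective
      (hinj (pt2_one_one_sub_mem_squareNhd_iff.2 hx) (pt2_one_one_sub_mem_squareNhd_iff.2 hy) hxy)
  · have hn : (∞ : ℕ∞ω) ≠ 0 := by simp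
    have hb : MDifferentiableAt 𝓘(ℝ, EuclideanSpace ℝ (Fin 2)) (𝓡 3) b.band (pt2 1 1 - x) :=
      b.contMDiff.mdifferentiableAt hn
    have hρ : MDifferentiableAt 𝓘(ℝ, EuclideanSpace ℝ (Fin 2)) 𝓘(ℝ, EuclideanSpace ℝ (Fin 2))
        (fun x : EuclideanSpace ℝ (Fin 2) ↦ pt2 1 1 - x) x :=
      hρs.contMDiff.mdifferentiableAt hn
    rw [hband, show (fun x ↦ b.band (pt2 1 1 - x)) =
        b.band ∘ (fun x : EuclideanSpace ℝ (Fin 2) ↦ pt2 1 1 - x) from rfl,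
      mfderiv_comp x hb hρ, mfderiv_eq_fderiv, fderiv_const_sub, fderiv_fun_id]
    intro v w hvw
    have hvw' : mfderiv 𝓘(ℝ, EuclideanSpace ℝ (Fin 2)) (𝓡 3) b.band (pt2 1 1 - x) (-v) =
        mfderiv 𝓘(ℝ, EuclideanSpace ℝ (Fin 2)) (𝓡 3) b.band (pt2 1 1 - x) (-w) := hvw
    exact neg_injective (himm _ (pt2_one_one_sub_mem_squareNhd_iff.2 hx) hvw')

end BandData

/-! ### Transport to normal position, with a regular presentation -/

namespace BandFoliation.KnotPiece.InTube

open KnotsInBall Knot.IsConicalConcordance SphereEmbedding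

variable {C : ChartData} {D : SegData C} {P : KnotPiece C D} {η ε : ℝ} {E : EndFrame η ε}
  {Kend tiny Knew : Knot}

/-- **Transport of a band sum in an end frame to normal position (regular presentation).** Under
the hypotheses of `isConnectedSum_of_transport`, `Knew` is isotopic to a knot `K₀ = Φ ∘ Knew`
with a *regular* normal presentation as a connected sum of `Kend` and `Kn`
(`Knot.IsRegularNormalConnectedSum`): transport the collar-shrunk data `bandDataₛ`
(`BandSumInTubeRegular.lean`, regular) instead of `bandData`; the crossing condition on the
smaller collar is the given one restricted, and regularity is preserved by the diffeomorphism
`Φ` (`BandData.IsRegular.of_band_eq_comp`). Cromwell (2004), §4.6. [folklore] -/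
theorem exists_isRegularNormalConnectedSum_of_transport (h : P.InTube E Kend tiny Knew) {Kn : Knot}
    (hKn : ∀ y, Kn y ≠ southPole) (T : EuclideanSpace ℝ (Fin 3) → EuclideanSpace ℝ (Fin 3)) {ρ' : ℝ} (hρ' : 0 < ρ')
    (Θ : AmbientIsotopy (𝓡 3) (sphere (0 : EuclideanSpace ℝ (Fin 4)) 1))
    (hΘ : ∀ z ∈ closedBall (0 : EuclideanSpace ℝ (Fin 3)) ρ', Θ.toFun 1 (psi.symm z) = E.cS (T z))
    (hT : MapsTo T (closedBall (0 : EuclideanSpace ℝ (Fin 3)) ρ') (region 0 η ε))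
    (htinyT : ∀ y, tiny y = E.cS (T (psi (Kn y))))
    (hKnb : ∀ y, psi (Kn y) ∈ ball (0 : EuclideanSpace ℝ (Fin 3)) ρ')
    (hKend : ∀ y, ∀ z ∈ closedBall (0 : EuclideanSpace ℝ (Fin 3)) ρ', Kend y ≠ E.cS (T z))
    (hcirc : ∀ x ∈ squareNhd C.δ, (C.B x ∈ T '' sphere (0 : EuclideanSpace ℝ (Fin 3)) ρ' ↔ x 0 = 2⁻¹)) :
    ∃ K₀ : Knot, Knew.IsIsotopic K₀ ∧ Knot.IsRegularNormalConnectedSum Kend Kn K₀ := by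
  have h2ρ : 0 < 2 / ρ' := by positivity
  -- the homothety isotopy and its transport along `ψ`
  obtain ⟨Λ, hΛ, R, hR⟩ := exists_ambientIsotopy_smul (κ := ρ' / 2) (by positivity) 2
  set Λs := Λ.alongChart (φ := psi) contMDiffOn_psi contMDiff_psi_symm psi_target hR with hΛs
  have hΛs_apply : ∀ y : sphere (0 : EuclideanSpace ℝ (Fin 4)) 1, y ≠ southPole →
      Λs.toFun 1 y = psi.symm (Λ.toFun 1 (psi y)) := fun y hy ↦ by
    rw [hΛs, AmbientIsotopy.alongChart_toFun, chartTransport_of_mem _ (mem_psi_source hy)]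
  set ΘD := Θ.toDiffeomorph 1 with hΘD
  set ΛD := Λs.toDiffeomorph 1 with hΛD
  set Φ : sphere (0 : EuclideanSpace ℝ (Fin 4)) 1 ≃ₘ⟮𝓡 3, 𝓡 3⟯ sphere (0 : EuclideanSpace ℝ (Fin 4)) 1 :=
    (ΘD.symm.trans ΛD.symm).trans halfTurn with hΦ
  have hΦ_apply : ∀ y, Φ y = halfTurn (ΛD.symm (ΘD.symm y)) := fun y ↦ rfl
  -- (K1) the composite `Θ₁ ∘ Λ₁ ∘ ψ⁻¹ ∘ (2/ρ')` is `cS ∘ T` on the closed ball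
  have key : ∀ z ∈ closedBall (0 : EuclideanSpace ℝ (Fin 3)) ρ',
      ΘD (ΛD (psi.symm ((2 / ρ') • z))) = E.cS (T z) := by
    intro z hz
    have hw : (2 / ρ') • z ∈ closedBall (0 : EuclideanSpace ℝ (Fin 3)) 2 := by
      rw [mem_closedBall_zero_iff, norm_smul, Real.norm_of_nonneg h2ρ.le]
      rw [mem_closedBall_zero_iff] at hz
      calc 2 / ρ' * ‖z‖ ≤ 2 / ρ' * ρ' := mul_le_mul_of_nonneg_left hz h2ρ.le
        _ = 2 := by field_simp
    show Θ.toFun 1 (Λs.toFun 1 (psi.symm ((2 / ρ') • z))) = _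
    rw [hΛs_apply _ (psi_symm_ne_southPole _), psi_apply_psi_symm,
      hΛ _ hw, smul_smul, show ρ' / 2 * (2 / ρ') = 1 by field_simp, one_smul, hΘ z hz]
  have hΦ_cS : ∀ z ∈ closedBall (0 : EuclideanSpace ℝ (Fin 3)) ρ',
      Φ (E.cS (T z)) = halfTurn (psi.symm ((2 / ρ') • z)) := by
    intro z hz
    rw [hΦ_apply, ← key z hz, Diffeomorph.symm_apply_apply, Diffeomorph.symm_apply_apply]
  -- (K3) a point off `cS (T (B̄(0, ρ')))` is carried into the open northern hemisphere
  have north : ∀ y : sphere (0 : EuclideanSpace ℝ (Fin 4)) 1,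
      (∀ z ∈ closedBall (0 : EuclideanSpace ℝ (Fin 3)) ρ', y ≠ E.cS (T z)) →
      0 < ((Φ y : sphere (0 : EuclideanSpace ℝ (Fin 4)) 1) : EuclideanSpace ℝ (Fin 4)) (Fin.last 3) := by
    intro y hy
    rw [hΦ_apply, halfTurn_apply_last, neg_pos]
    by_contra hge
    push Not at hge
    set q := ΛD.symm (ΘD.symm y) with hq
    obtain ⟨hq1, hq2⟩ := eq_psi_symm_of_last_nonneg hge
    set z := (ρ' / 2) • psi q with hz
    have hzb : z ∈ closedBall (0 : EuclideanSpace ℝ (Fin 3)) ρ' := by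
      rw [mem_closedBall_zero_iff, hz, norm_smul, Real.norm_of_nonneg (by positivity)]
      calc ρ' / 2 * ‖psi q‖ ≤ ρ' / 2 * 2 := mul_le_mul_of_nonneg_left hq2 (by positivity)
        _ = ρ' := by ring
    have hzq : (2 / ρ') • z = psi q := by
      rw [hz, smul_smul, show 2 / ρ' * (ρ' / 2) = 1 by field_simp, one_smul]
    apply hy z hzb
    rw [← key z hzb, hzq, ← hq1, hq, Diffeomorph.apply_symm_apply, Diffeomorph.apply_symm_apply]
  -- the three knots carried by `Φ`
  have hN : (Kend.map Φ).InNorth := fun x ↦ north _ (hKend x)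
  have hS : (tiny.map Φ).InSouth := by
    intro x
    rw [SphereEmbedding.map_apply, htinyT, hΦ_cS _ (ball_subset_closedBall (hKnb x)), halfTurn_apply_last,
      neg_lt_zero, psi_symm_pos_iff, norm_smul, Real.norm_of_nonneg h2ρ.le]
    have := mem_ball_zero_iff.1 (hKnb x)
    calc 2 / ρ' * ‖psi (Kn x)‖ < 2 / ρ' * ρ' := mul_lt_mul_of_pos_left this h2ρ
      _ = 2 := by field_simp
  -- isotopies: `K ≅ Φ ∘ K` for every knot, and `tiny = Θ₁ ∘ Kn`
  have hiso : ∀ K : Knot, K.IsIsotopic (K.map Φ) := by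
    intro K
    rw [hΦ, ← map_map, ← map_map]
    refine SphereEmbedding.IsIsotopic.trans_holds ?_ (((K.map ΘD.symm).map ΛD.symm).isIsotopic_map_halfTurn)
    refine SphereEmbedding.IsIsotopic.trans_holds ?_ ((isIsotopic_map_symm (K.map ΘD.symm) Λs))
    exact isIsotopic_map_symm K Θ
  have htinyΘ : tiny = Kn.map ΘD := by
    apply DFunLike.coe_injective
    funext y
    rw [SphereEmbedding.coe_map, comp_apply, hΘD, AmbientIsotopy.coe_toDiffeomorph, htinyT,
      ← hΘ _ (ball_subset_closedBall (hKnb y)), psi_symm_apply_psi (hKn y)]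
  have hKn_tiny : Kn.IsIsotopic (tiny.map Φ) := by
    refine SphereEmbedding.IsIsotopic.trans_holds ?_ (hiso tiny)
    rw [htinyΘ]; exact Kn.isIsotopic_map Θ
  -- the transported band data and the crossing condition
  obtain ⟨b', hband, hδ⟩ := h.bandDataₛ.exists_map Φ
  have hreg : b'.IsRegular := h.isRegular_bandDataₛ.of_band_eq_comp Φ hband hδ
  have hsub : squareNhd D.δₛ ⊆ squareNhd C.δ := D.squareNhd_δₛ_subset
  have hcross : b'.band ⁻¹' sphereEquator 2 ∩ squareNhd b'.δ = {x ∈ squareNhd b'.δ | x 0 = 2⁻¹} := by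
    rw [hband, hδ, bandDataₛ_δ, bandDataₛ_band]
    ext x
    simp only [mem_inter_iff, mem_preimage, comp_apply, mem_setOf_eq]
    constructor
    · rintro ⟨hx, hsq⟩
      refine ⟨hsq, (hcirc x (hsub hsq)).1 ?_⟩
      -- `Φ (cS (B x))` on the equator: pull back along `key`
      rw [hΦ_apply, mem_sphereEquator_iff, halfTurn_apply_last, neg_eq_zero] at hx
      set q := ΛD.symm (ΘD.symm (E.cS (C.B x))) with hq
      obtain ⟨hq1, -⟩ := eq_psi_symm_of_last_nonneg hx.ge
      have hq2 : ‖psi q‖ = 2 := by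
        rw [← psi_symm_mem_sphereEquator_iff, ← hq1]; exact (mem_sphereEquator_iff _).2 hx
      set z := (ρ' / 2) • psi q with hz
      have hzs : z ∈ sphere (0 : EuclideanSpace ℝ (Fin 3)) ρ' := by
        rw [mem_sphere_zero_iff_norm, hz, norm_smul, Real.norm_of_nonneg (by positivity), hq2]; ring
      have hzq : (2 / ρ') • z = psi q := by
        rw [hz, smul_smul, show 2 / ρ' * (ρ' / 2) = 1 by field_simp, one_smul]
      have hkey := key z (sphere_subset_closedBall hzs)
      rw [hzq, ← hq1, hq, Diffeomorph.apply_symm_apply, Diffeomorph.apply_symm_apply] at hkey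
      refine ⟨z, hzs, (E.injOn_c (hT (sphere_subset_closedBall hzs)) (h.B_mem x) ?_).symm |>.symm⟩
      simpa using
        (congrArg (fun p : sphere (0 : EuclideanSpace ℝ (Fin 4)) 1 ↦ (p : EuclideanSpace ℝ (Fin 4))) hkey).symm
    · rintro ⟨hsq, hx0⟩
      refine ⟨?_, hsq⟩
      obtain ⟨z, hz, hzB⟩ := (hcirc x (hsub hsq)).2 hx0
      rw [← hzB, hΦ_cS z (sphere_subset_closedBall hz), mem_sphereEquator_iff, halfTurn_apply_last,
        neg_eq_zero, ← mem_sphereEquator_iff, psi_symm_mem_sphereEquator_iff, norm_smul,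
        Real.norm_of_nonneg h2ρ.le, mem_sphere_zero_iff_norm.1 hz]
      field_simp
  -- the regular normal presentation of `Φ ∘ Knew`
  exact ⟨Knew.map Φ, hiso Knew, Kend.map Φ, tiny.map Φ, hiso Kend, hKn_tiny, hN, hS, b', hcross, hreg⟩

end BandFoliation.KnotPiece.InTube

/-! ### The carrying construction with regular normally presented ends -/

namespace Knot.IsConicalConcordance

open KnotsInBall StripFrame BandFoliation ChartData KnotPiece AffineIsotopy

variable {K K' : Knot} {f : (sphere (0 : EuclideanSpace ℝ (Fin 2)) 1) × ℝ → EuclideanSpace ℝ (Fin 4)} {δ : ℝ}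
  (h : IsConicalConcordance K K' f δ) {w : EuclideanSpace ℝ (Fin 4)}
  {η ε : ℝ}

/-- **The carrying construction for a given model, regular normally presented ends** (as
`exists_isNormalConnectedSum_isConcordant_of_model`, with
`KnotPiece.InTube.exists_isRegularNormalConnectedSum_of_transport`). [cite: FoxMilnor1966, §1] -/
theorem exists_isRegularNormalConnectedSum_isConcordant_of_model (G : (h.setup w).GoodTube 0 η ε)
    (md : ModelData)
    (hη1 : η ≤ 1) (hℓη : md.l * md.ℓ ≤ η / 8)
    (hρη : 8 * md.l * md.ρ' ≤ η) (haε : 2 * md.a < ε)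
    (F₁ F₂ : AmbientIsotopy 𝓘(ℝ, EuclideanSpace ℝ (Fin 3)) (EuclideanSpace ℝ (Fin 3)))
    (hF₁ : ∀ z ∈ closedBall (0 : EuclideanSpace ℝ (Fin 3)) md.ρ', F₁.toFun 1 z = h.g₁ w (md.T z)) {R₁ : ℝ}
    (hR₁ : ∀ t (y : EuclideanSpace ℝ (Fin 3)), R₁ ≤ ‖y‖ → F₁.toFun t y = y)
    (hF₂ : ∀ z ∈ closedBall (0 : EuclideanSpace ℝ (Fin 3)) md.ρ', F₂.toFun 1 z = h.g₂ w (md.T z)) {R₂ : ℝ}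
    (hR₂ : ∀ t (y : EuclideanSpace ℝ (Fin 3)), R₂ ≤ ‖y‖ → F₂.toFun t y = y)
    (hTW : ∀ z ∈ closedBall (0 : EuclideanSpace ℝ (Fin 3)) md.ρ', md.T z ∈ h.W₁ w ∩ h.W₂ w) :
    ∃ L L' : Knot, IsRegularNormalConnectedSum K md.Kn L ∧ IsRegularNormalConnectedSum K' md.Kn L' ∧
      L.IsConcordant L' := by
  have hρ' := md.ρ'_pos
  -- the tube fit and the detour
  have hfit : md.piece.TubeFit η ε := md.tubeFit hη1 hℓη hρη haε
  set Dt := KnotPiece.detour hfit with hDt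
  -- `T` maps the chart image of `Kn` into the region
  have hT : ∀ y, affT md.x₀ md.p md.M md.l (psi (md.Kn y)) ∈ region 0 η ε := fun y ↦
    (md.T_mem hρη haε (ball_subset_closedBall (md.psi_mem_ball y))).2.2.2
  -- the knots
  set tiny₁ := h.tinyKnot₁ (w := w) G md.hKn md.l_pos.ne' hT with htiny₁
  set tiny₂ := h.tinyKnot₂ (w := w) G md.hKn md.l_pos.ne' hT with htiny₂
  set N₁ := h.newKnot₁ Dt G with hN₁
  set N₂ := h.newKnot₂ Dt G with hN₂
  -- the two band-sum configurations
  have in₁ : md.piece.InTube (h.endFrame₁ G) K tiny₁ N₁ :=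
    { fit := hfit
      lo3 := md.lo3 hℓη
      hi3 := md.hi3 hℓη
      hKend := fun u ↦ h.coe_K_circlePt u
      htiny := fun θ ↦ by
        rw [htiny₁, h.coe_tinyKnot₁, endFrame₁_c, ModelData.piece_k, ModelData.k_apply]; rfl
      hKnew := fun u ↦ by
        rw [hN₁, circlePt_eq_circlePoint, h.coe_newKnot₁_circlePoint, mul_div_cancel_left₀ _ (by positivity),
          endFrame₁_c]
        rfl
      separated := fun x hx hd u he' ↦ h.separated₁ G x hx hd u he'
      clean := md.clean }
  have in₂ : md.piece.InTube (h.endFrame₂ G) K' tiny₂ N₂ :=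
    { fit := hfit
      lo3 := md.lo3 hℓη
      hi3 := md.hi3 hℓη
      hKend := fun u ↦ h.coe_K'_circlePt u
      htiny := fun θ ↦ by
        rw [htiny₂, h.coe_tinyKnot₂, endFrame₂_c, ModelData.piece_k, ModelData.k_apply]; rfl
      hKnew := fun u ↦ by
        rw [hN₂, circlePt_eq_circlePoint, h.coe_newKnot₂_circlePoint, mul_div_cancel_left₀ _ (by positivity),
          endFrame₂_c]
        rfl
      separated := fun x hx hd u he' ↦ h.separated₂ G x hx hd u he'
      clean := md.clean }
  -- the transported isotopies on `𝕊³`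
  set Θ₁ := F₁.alongChart (φ := psi) contMDiffOn_psi contMDiff_psi_symm psi_target hR₁ with hΘ₁
  set Θ₂ := F₂.alongChart (φ := psi) contMDiffOn_psi contMDiff_psi_symm psi_target hR₂ with hΘ₂
  have hΘ₁' : ∀ z ∈ closedBall (0 : EuclideanSpace ℝ (Fin 3)) md.ρ',
      Θ₁.toFun 1 (psi.symm z) = (h.endFrame₁ G).cS (md.T z) := by
    intro z hz
    rw [hΘ₁, AmbientIsotopy.alongChart_toFun, chartTransport_of_mem _ (mem_psi_source (psi_symm_ne_southPole z)),
      psi_apply_psi_symm, hF₁ z hz, endFrame₁_cS]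
    exact psi_symm_apply_psi (hTW z hz).1
  have hΘ₂' : ∀ z ∈ closedBall (0 : EuclideanSpace ℝ (Fin 3)) md.ρ',
      Θ₂.toFun 1 (psi.symm z) = (h.endFrame₂ G).cS (md.T z) := by
    intro z hz
    rw [hΘ₂, AmbientIsotopy.alongChart_toFun, chartTransport_of_mem _ (mem_psi_source (psi_symm_ne_southPole z)),
      psi_apply_psi_symm, hF₂ z hz, endFrame₂_cS]
    exact psi_symm_apply_psi (hTW z hz).2
  have hTmaps : MapsTo md.T (closedBall (0 : EuclideanSpace ℝ (Fin 3)) md.ρ') (region 0 η ε) := fun z hz ↦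
    (md.T_mem hρη haε hz).2.2.2
  -- the regular normal presentations
  have hsum₁ : ∃ N₀, N₁.IsIsotopic N₀ ∧ IsRegularNormalConnectedSum K md.Kn N₀ := by
    refine in₁.exists_isRegularNormalConnectedSum_of_transport md.hKn md.T hρ' Θ₁ hΘ₁' hTmaps (fun y ↦ ?_)
      md.psi_mem_ball (fun y z hz heq ↦ ?_) (fun x hx ↦ md.B_mem_image_iff hx)
    · apply Subtype.ext; rw [htiny₁, h.coe_tinyKnot₁, endFrame₁_cS, coe_cS₁]; rfl
    · obtain ⟨v, -, rfl⟩ := InTube.exists_window (C := md.chart) y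
      obtain ⟨h0, hd, hpos, -⟩ := md.T_mem hρη haε hz
      have := (in₁.separated (md.T z) h0 hd v (by rw [heq]; rfl)).1
      linarith
  have hsum₂ : ∃ N₀, N₂.IsIsotopic N₀ ∧ IsRegularNormalConnectedSum K' md.Kn N₀ := by
    refine in₂.exists_isRegularNormalConnectedSum_of_transport md.hKn md.T hρ' Θ₂ hΘ₂' hTmaps (fun y ↦ ?_)
      md.psi_mem_ball (fun y z hz heq ↦ ?_) (fun x hx ↦ md.B_mem_image_iff hx)
    · apply Subtype.ext; rw [htiny₂, h.coe_tinyKnot₂, endFrame₂_cS, coe_cS₂]; rfl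
    · obtain ⟨v, -, rfl⟩ := InTube.exists_window (C := md.chart) y
      obtain ⟨h0, hd, hpos, -⟩ := md.T_mem hρη haε hz
      have := (in₂.separated (md.T z) h0 hd v (by rw [heq]; rfl)).1
      linarith
  -- isotopic knots are concordant: pass from `N₁ ~ N₂` to the normally presented copies
  obtain ⟨L, hL, hLn⟩ := hsum₁
  obtain ⟨L', hL', hL'n⟩ := hsum₂
  have hc : N₁.IsConcordant N₂ := ⟨_, h.isConcordance_newAnnulus Dt G⟩
  exact ⟨L, L', hLn, hL'n, equivalence_isConcordant_holds.trans
    (equivalence_isConcordant_holds.symm (IsConcordant.of_isIsotopic_holds hL))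
    (equivalence_isConcordant_holds.trans hc (IsConcordant.of_isIsotopic_holds hL'))⟩

/-- **Fox–Milnor's carrying construction, regular normally presented ends** (as
`exists_isNormalConnectedSum_isConcordant`: flat arc, height, frame, scale, collar width, then
`exists_isRegularNormalConnectedSum_isConcordant_of_model`). [cite: FoxMilnor1966, §1] -/
theorem exists_isRegularNormalConnectedSum_isConcordant (G : (h.setup w).GoodTube 0 η ε) (K₂ : Knot) :
    ∃ L L' : Knot, IsRegularNormalConnectedSum K K₂ L ∧ IsRegularNormalConnectedSum K' K₂ L' ∧
      L.IsConcordant L' := by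
  have hε := G.ε_pos
  have hη := G.η_pos
  have hη4 := G.η_le
  -- the flat arc of the second summand
  obtain ⟨Kn, hK₂Kn, hKn, p, e, ℓ, ν, he, he2, hℓ, hν, hlow, hbox, α, θ₁, β, σ, hαθ, hθβ, hβ, hσ, hσ',
    -, hσα, hσβ, hseg⟩ := K₂.exists_flatArc_param
  -- a bound of the second summand in the chart
  obtain ⟨Rb, hRb⟩ : ∃ Rb : ℝ, ∀ y, ‖psi (Kn y)‖ ≤ Rb := by
    obtain ⟨R, hR⟩ := (isCompact_range (Knot.contMDiff_psi_comp hKn).continuous).isBounded.exists_norm_le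
    exact ⟨R, fun y ↦ hR _ ⟨y, rfl⟩⟩
  have hRb0 : 0 ≤ Rb := le_trans (norm_nonneg _) (hRb (circlePoint 0))
  have hρ'pos : 0 < Rb + 1 := by linarith
  -- the height of the band
  obtain ⟨a, ha, hx₁, hx₂⟩ := h.exists_height G
  have ha0 : 0 < a := by linarith [ha.1]
  have hx₀reg : (a • e3 1 : EuclideanSpace ℝ (Fin 3)) ∈ region 0 η ε := by
    refine ⟨by simp [hη], ?_⟩
    simp only [PiLp.smul_apply, e3_apply, smul_eq_mul]
    simp
    rw [abs_of_pos ha0]; linarith [ha.2]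
  -- the frame, oriented compatibly with the lower end chart
  obtain ⟨s, hs, hdet⟩ := exists_frameOf_det_pos (equivOfInjective _ (h.injective_fderiv_g₁ G hx₀reg hx₁)) he he2
  rw [coe_equivOfInjective] at hdet
  -- the two linearised transports on the model ball
  have hWo : IsOpen (region 0 η ε ∩ (h.W₁ w ∩ h.W₂ w)) :=
    (isOpen_region 0 η ε).inter ((h.isOpen_W₁ w).inter (h.isOpen_W₂ w))
  have hxW : (a • e3 1 : EuclideanSpace ℝ (Fin 3)) ∈ region 0 η ε ∩ (h.W₁ w ∩ h.W₂ w) := ⟨hx₀reg, hx₁, hx₂⟩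
  have hg₁ : ContDiffOn ℝ ∞ (h.g₁ w) (region 0 η ε ∩ (h.W₁ w ∩ h.W₂ w)) :=
    (h.contDiffOn_g₁ w).mono fun x hx ↦ hx.2.1
  have hg₂ : ContDiffOn ℝ ∞ (h.g₂ w) (region 0 η ε ∩ (h.W₁ w ∩ h.W₂ w)) :=
    (h.contDiffOn_g₂ w).mono fun x hx ↦ hx.2.2
  have hL₁' : HasFDerivAt (h.g₁ w)
      (equivOfInjective _ (h.injective_fderiv_g₁ G hx₀reg hx₁) :
        EuclideanSpace ℝ (Fin 3) →L[ℝ] EuclideanSpace ℝ (Fin 3)) (a • e3 1) := by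
    rw [coe_equivOfInjective]; exact (h.differentiableAt_g₁ hx₁).hasFDerivAt
  have hL₂' : HasFDerivAt (h.g₂ w)
      (equivOfInjective _ (h.injective_fderiv_g₂ G hx₀reg hx₂) :
        EuclideanSpace ℝ (Fin 3) →L[ℝ] EuclideanSpace ℝ (Fin 3)) (a • e3 1) := by
    rw [coe_equivOfInjective]; exact (h.differentiableAt_g₂ hx₂).hasFDerivAt
  have hM₁ : 0 < (toMat ((equivOfInjective _ (h.injective_fderiv_g₁ G hx₀reg hx₁) :
      EuclideanSpace ℝ (Fin 3) →L[ℝ] EuclideanSpace ℝ (Fin 3)).comp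
      (frameOf he he2 hs : EuclideanSpace ℝ (Fin 3) →L[ℝ] EuclideanSpace ℝ (Fin 3)))).det := by
    rw [coe_equivOfInjective]; exact hdet
  have hM₂ : 0 < (toMat ((equivOfInjective _ (h.injective_fderiv_g₂ G hx₀reg hx₂) :
      EuclideanSpace ℝ (Fin 3) →L[ℝ] EuclideanSpace ℝ (Fin 3)).comp
      (frameOf he he2 hs : EuclideanSpace ℝ (Fin 3) →L[ℝ] EuclideanSpace ℝ (Fin 3)))).det := by
    rw [coe_equivOfInjective]; exact h.det_toMat_comp_pos G hx₀reg hx₁ hx₂ _ hdet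
  have hZc : IsCompact (closedBall (0 : EuclideanSpace ℝ (Fin 3)) (Rb + 1)) := isCompact_closedBall _ _
  obtain ⟨l₁, hl₁, H₁⟩ := exists_ambientIsotopy_comp_affine hWo hg₁ hxW _ _ hL₁' hM₁ hZc p
  obtain ⟨l₂, hl₂, H₂⟩ := exists_ambientIsotopy_comp_affine hWo hg₂ hxW _ _ hL₂' hM₂ hZc p
  -- the scale
  obtain ⟨l, hlpos, hll₁, hll₂, hl_a, hl_η, hl_ℓ⟩ : ∃ l : ℝ, 0 < l ∧ l < l₁ ∧ l < l₂ ∧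
      16 * l * (Rb + 1) ≤ a ∧ 8 * l * (Rb + 1) ≤ η ∧ l * ℓ ≤ η / 8 := by
    refine ⟨min (min l₁ l₂ / 2) (min (a / (16 * (Rb + 1))) (min (η / (8 * (Rb + 1))) (η / (8 * ℓ)))),
      lt_min (by positivity) (lt_min (by positivity) (lt_min (by positivity) (by positivity))), ?_, ?_, ?_, ?_, ?_⟩
    · have h1 : min (min l₁ l₂ / 2) (min (a / (16 * (Rb + 1))) (min (η / (8 * (Rb + 1))) (η / (8 * ℓ)))) ≤
        min l₁ l₂ / 2 := min_le_left _ _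
      have := min_le_left l₁ l₂; linarith
    · have h1 : min (min l₁ l₂ / 2) (min (a / (16 * (Rb + 1))) (min (η / (8 * (Rb + 1))) (η / (8 * ℓ)))) ≤
        min l₁ l₂ / 2 := min_le_left _ _
      have := min_le_right l₁ l₂; linarith
    · have h1 : min (min l₁ l₂ / 2) (min (a / (16 * (Rb + 1))) (min (η / (8 * (Rb + 1))) (η / (8 * ℓ)))) ≤
        a / (16 * (Rb + 1)) := (min_le_right _ _).trans (min_le_left _ _)
      rw [le_div_iff₀ (by positivity)] at h1; linarith
    · have h1 : min (min l₁ l₂ / 2) (min (a / (16 * (Rb + 1))) (min (η / (8 * (Rb + 1))) (η / (8 * ℓ)))) ≤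
        η / (8 * (Rb + 1)) := ((min_le_right _ _).trans (min_le_right _ _)).trans (min_le_left _ _)
      rw [le_div_iff₀ (by positivity)] at h1; linarith
    · have h1 : min (min l₁ l₂ / 2) (min (a / (16 * (Rb + 1))) (min (η / (8 * (Rb + 1))) (η / (8 * ℓ)))) ≤
        η / (8 * ℓ) := ((min_le_right _ _).trans (min_le_right _ _)).trans (min_le_right _ _)
      rw [le_div_iff₀ (by positivity)] at h1; linarith
  obtain ⟨hTW, F₁, hF₁, R₁, hR₁⟩ := H₁ l ⟨hlpos, hll₁⟩
  obtain ⟨-, F₂, hF₂, R₂, hR₂⟩ := H₂ l ⟨hlpos, hll₂⟩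
  -- the collar width
  obtain ⟨δ', hδ'pos, hδ'le, hδ'room, hδ'up, hδ'clean⟩ : ∃ δ' : ℝ, 0 < δ' ∧ δ' ≤ 1 / 8 ∧
      δ' * (16 * a * (Rb + 1)) ≤ l ∧ δ' * (16 * (Rb + 1) ^ 2) < 1 ∧ δ' * (2 * a) ≤ l * ν := by
    refine ⟨min (1 / 8) (min (l / (16 * a * (Rb + 1))) (min (1 / (32 * (Rb + 1) ^ 2)) (l * ν / (2 * a)))),
      lt_min (by norm_num) (lt_min (by positivity) (lt_min (by positivity) (by positivity))), min_le_left _ _,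
      ?_, ?_, ?_⟩
    · have h1 : min (1 / 8) (min (l / (16 * a * (Rb + 1))) (min (1 / (32 * (Rb + 1) ^ 2)) (l * ν / (2 * a)))) ≤
        l / (16 * a * (Rb + 1)) := (min_le_right _ _).trans (min_le_left _ _)
      rwa [le_div_iff₀ (by positivity)] at h1
    · have h1 : min (1 / 8) (min (l / (16 * a * (Rb + 1))) (min (1 / (32 * (Rb + 1) ^ 2)) (l * ν / (2 * a)))) ≤
        1 / (32 * (Rb + 1) ^ 2) := ((min_le_right _ _).trans (min_le_right _ _)).trans (min_le_left _ _)
      rw [le_div_iff₀ (by positivity)] at h1; nlinarith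
    · have h1 : min (1 / 8) (min (l / (16 * a * (Rb + 1))) (min (1 / (32 * (Rb + 1) ^ 2)) (l * ν / (2 * a)))) ≤
        l * ν / (2 * a) := ((min_le_right _ _).trans (min_le_right _ _)).trans (min_le_right _ _)
      rwa [le_div_iff₀ (by positivity)] at h1
  -- the model
  let md : ModelData :=
    { Kn := Kn, hKn := hKn, p := p, e := e, ℓ := ℓ, ν := ν, α := α, β := β, σ := σ, norm_e := he,
      e_two := he2, ℓ_pos := hℓ, ν_pos := hν, lowest := hlow, box := hbox, α_lt_β := hαθ.trans hθβ,
      β_lt := hβ, contDiff_σ := hσ, deriv_σ_pos := hσ', σ_α := hσα, σ_β := hσβ, seg := hseg, Rb := Rb,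
      ρ' := Rb + 1, norm_le := hRb, ρ'_ge := le_rfl, M := frameOf he he2 hs, M_zero := frameOf_zero he he2 hs,
      M_one := frameOf_one he he2 hs, norm_M := norm_frameOf he he2 hs, a := a, l := l, δ := δ',
      a_pos := ha0, l_pos := hlpos, δ_pos := hδ'pos, δ_le := hδ'le, l_le := hl_a, δ_room := hδ'room,
      δ_up := hδ'up, δ_clean := hδ'clean }
  have hmdT : ∀ z, md.T z = a • e3 1 + l • frameOf he he2 hs (z - p) := fun z ↦ rfl
  obtain ⟨L, L', hL, hL', hc⟩ := h.exists_isRegularNormalConnectedSum_isConcordant_of_model G md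
    (by linarith)
    hl_ℓ hl_η (by linarith [ha.2]) F₁ F₂ (fun z hz ↦ by rw [hmdT]; exact hF₁ z hz) hR₁
    (fun z hz ↦ by rw [hmdT]; exact hF₂ z hz) hR₂ (fun z hz ↦ by rw [hmdT]; exact (hTW z hz).2)
  -- back to `K₂`
  refine ⟨L, L', ?_, ?_, hc⟩
  · obtain ⟨A', B', hA', hB', rest⟩ := hL
    exact ⟨A', B', hA', SphereEmbedding.IsIsotopic.trans_holds hK₂Kn hB', rest⟩
  · obtain ⟨A', B', hA', hB', rest⟩ := hL'
    exact ⟨A', B', hA', SphereEmbedding.IsIsotopic.trans_holds hK₂Kn hB', rest⟩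

end Knot.IsConicalConcordance

/-! ### Regular normal presentations: factors up to isotopy, exchange of the summands -/

namespace Knot

open SphereEmbedding (InNorth InSouth)

/-- A regular normal presentation is a normal presentation. [folklore] -/
theorem IsRegularNormalConnectedSum.isNormalConnectedSum {K₁ K₂ K : Knot}
    (h : IsRegularNormalConnectedSum K₁ K₂ K) : IsNormalConnectedSum K₁ K₂ K := by
  obtain ⟨A, B, hA, hB, hAN, hBS, b, hcross, -⟩ := h
  exact ⟨A, B, hA, hB, hAN, hBS, b, hcross⟩

/-- A regular normal presentation of `K` as `K₁ # K₂` is one as `K₁' # K₂'` for isotopic factors.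
[folklore] -/
theorem IsRegularNormalConnectedSum.of_isIsotopic {K₁ K₂ K₁' K₂' K : Knot}
    (h : IsRegularNormalConnectedSum K₁ K₂ K) (h₁ : K₁.IsIsotopic K₁') (h₂ : K₂.IsIsotopic K₂') :
    IsRegularNormalConnectedSum K₁' K₂' K := by
  obtain ⟨A, B, hA, hB, rest⟩ := h
  exact ⟨A, B, SphereEmbedding.IsIsotopic.trans_holds (SphereEmbedding.IsIsotopic.symm_holds h₁) hA,
    SphereEmbedding.IsIsotopic.trans_holds (SphereEmbedding.IsIsotopic.symm_holds h₂) hB, rest⟩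

/-- **Exchange of the summands of a regular normal presentation** (as `IsNormalConnectedSum.swap`:
half-turn of the band square, then the half-turn `rot_π` of `𝕊³`; regularity survives both,
`BandData.IsRegular.of_band_eq_halfTurn`, `BandData.IsRegular.of_band_eq_comp`). [folklore] -/
theorem IsRegularNormalConnectedSum.swap {K₁ K₂ K : Knot} (h : IsRegularNormalConnectedSum K₁ K₂ K) :
    IsRegularNormalConnectedSum K₂ K₁ (K.map halfTurn) := by
  obtain ⟨A, B, hA, hB, hAN, hBS, b, hcross, hreg⟩ := h
  have hdisj : Disjoint (range A) (range B) := disjoint_range_of_inNorth_inSouth hAN hBS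
  obtain ⟨b', hδ', hband'⟩ := b.exists_halfTurn hdisj
  have hreg' : b'.IsRegular := hreg.of_band_eq_halfTurn hband' hδ'
  have hcross' : b'.band ⁻¹' sphereEquator 2 ∩ squareNhd b'.δ = {x ∈ squareNhd b'.δ | x 0 = 2⁻¹} := by
    rw [hband', hδ']
    ext x
    have hx := Set.ext_iff.mp hcross (pt2 1 1 - x)
    simp only [mem_inter_iff, mem_preimage, mem_setOf_eq, pt2_one_one_sub_mem_squareNhd_iff,
      pt2_one_one_sub_apply] at hx ⊢
    rw [hx]
    exact and_congr_right fun _ ↦ ⟨fun h ↦ by linarith, fun h ↦ by linarith⟩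
  obtain ⟨b'', hband'', hδ''⟩ := b'.exists_map halfTurn
  refine ⟨B.map halfTurn, A.map halfTurn,
    SphereEmbedding.IsIsotopic.trans_holds hB (B.isIsotopic_map_halfTurn),
    SphereEmbedding.IsIsotopic.trans_holds hA (A.isIsotopic_map_halfTurn),
    hBS.map_halfTurn, hAN.map_halfTurn, b'', ?_, hreg'.of_band_eq_comp halfTurn hband'' hδ''⟩
  rw [hband'', hδ'', ← halfTurn_image_sphereEquator, Set.preimage_comp,
    Set.preimage_image_eq _ (show Injective ⇑halfTurn from halfTurn.injective)]
  exact hcross'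

/-! ### The one-sided facts with regular normal presentations -/

/-- **Connected sum of a concordance with a fixed knot (first factor), regular normal
presentations** (as `exists_isNormalConnectedSum_isConcordant_left`). Fox–Milnor (1966), §1.
[cite: FoxMilnor1966, §1] -/
theorem exists_isRegularNormalConnectedSum_isConcordant_left {K₁ K₁' : Knot} (K₂ : Knot)
    (hc : K₁.IsConcordant K₁') :
    ∃ K K' : Knot, IsRegularNormalConnectedSum K₁ K₂ K ∧ IsRegularNormalConnectedSum K₁' K₂ K' ∧
      K.IsConcordant K' := by
  obtain ⟨f₀, hf₀⟩ := hc
  obtain ⟨f, hf, δ, hδ, hδ4, hc₁, hc₂⟩ := hf₀.exists_conical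
  have h : IsConicalConcordance K₁ K₁' f δ := ⟨hf, hδ, hδ4, hc₁, hc₂⟩
  obtain ⟨w, η, ε, G⟩ := h.exists_goodTube 0
  exact h.exists_isRegularNormalConnectedSum_isConcordant G K₂

/-- **Connected sum of a fixed knot with a concordance (second factor), regular normal
presentations** (from the first factor by `IsRegularNormalConnectedSum.swap`).
[cite: FoxMilnor1966, §1] -/
theorem exists_isRegularNormalConnectedSum_isConcordant_right (K₁ : Knot) {K₂ K₂' : Knot}
    (hc : K₂.IsConcordant K₂') :
    ∃ K K' : Knot, IsRegularNormalConnectedSum K₁ K₂ K ∧ IsRegularNormalConnectedSum K₁ K₂' K' ∧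
      K.IsConcordant K' := by
  obtain ⟨P, P', hP, hP', hc'⟩ := exists_isRegularNormalConnectedSum_isConcordant_left K₁ hc
  refine ⟨P.map halfTurn, P'.map halfTurn, hP.swap, hP'.swap, ?_⟩
  exact equivalence_isConcordant_holds.trans
    (equivalence_isConcordant_holds.symm (IsConcordant.of_isIsotopic_holds (P.isIsotopic_map_halfTurn)))
    (equivalence_isConcordant_holds.trans hc' (IsConcordant.of_isIsotopic_holds (P'.isIsotopic_map_halfTurn)))

/-! ### Assembly -/

/-- **Two regular normal presentations with isotopic summands give isotopic knots**, granted
Schubert's theorem in normal position for regular presentations (`hH`): match the summands by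
the knots-in-a-ball theorem (`IsRegularNormalConnectedSum.exists_bandData_eq`, regularity
preserved), then apply `hH`. Cromwell (2004), §4.6. [cite: Cromwell2004, §4.6 (PDF p. 69)] -/
theorem IsRegularNormalConnectedSum.isIsotopic_of_normalPosition_regular
    (hH : Schubert1949_normalPosition_regular) {K₁ K₂ L L' : Knot}
    (hL : IsRegularNormalConnectedSum K₁ K₂ L) (hL' : IsRegularNormalConnectedSum K₁ K₂ L') :
    L.IsIsotopic L' := by
  obtain ⟨A, B, hA, hB, hAN, hBS, b, hcross, hreg⟩ := hL
  obtain ⟨L'', hL'L'', b'', hcross'', hreg''⟩ := hL'.exists_bandData_eq hA hB hAN hBS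
  exact IsAmbientIsotopic.trans_holds (hH b b'' hAN hBS hreg hreg'' hcross hcross'')
    (IsAmbientIsotopic.symm_holds hL'L'')

/-- **The connected sum of concordances from Schubert's theorem in normal position, printed
(regular) form.** The named fact `Knot.exists_isConnectedSum_isConcordant`
(`BandSumConcordance.lean`) follows from `Schubert1949_normalPosition_regular` alone: chain
`K₁ # K₂ ~ K₁' # K₂` (`exists_isRegularNormalConnectedSum_isConcordant_left`), the isotopy between
the two regular normally presented witnesses of `K₁' # K₂`
(`IsRegularNormalConnectedSum.isIsotopic_of_normalPosition_regular`) and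
`K₁' # K₂ ~ K₁' # K₂'` (`exists_isRegularNormalConnectedSum_isConcordant_right`). Fox–Milnor
(1966), §1; Livingston (2005), Thm. 2.2. [cite: FoxMilnor1966, §1] -/
theorem exists_isConnectedSum_isConcordant_of_normalPosition_regular
    (hH : Schubert1949_normalPosition_regular) : exists_isConnectedSum_isConcordant := by
  intro K₁ K₂ K₁' K₂' h₁ h₂
  obtain ⟨L, L', hL, hL', hc⟩ := exists_isRegularNormalConnectedSum_isConcordant_left K₂ h₁
  obtain ⟨M, M', hM, hM', hc'⟩ := exists_isRegularNormalConnectedSum_isConcordant_right K₁' h₂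
  have hmid : L'.IsConcordant M :=
    IsConcordant.of_isIsotopic_holds (hL'.isIsotopic_of_normalPosition_regular hH hM)
  exact ⟨L, M', hL.isNormalConnectedSum.isConnectedSum, hM'.isNormalConnectedSum.isConnectedSum,
    equivalence_isConcordant_holds.trans hc (equivalence_isConcordant_holds.trans hmid hc')⟩

/-- **The connected sum of concordances, reduced to Schubert's theorem for rebuilt presentations
in normal position alone.** Since `BandSumIsotopyRegularProofs.lean` *proves* the printed band
fact (`BandData.isIsotopic_of_band_eq_of_isRegular_holds`, by the lifted-arc construction), the
regular form of Schubert's theorem follows from the heart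
`Knot.Schubert1949_normalPosition_rebuilt` (`SchubertNormalForm.lean`) alone
(`Schubert1949_normalPosition_regular_of_rebuilt`, `SchubertRegular.lean`), and with it the named
fact `Knot.exists_isConnectedSum_isConcordant`: the upstream set of the fact is the single named
fact `Knot.Schubert1949_normalPosition_rebuilt` (or, directly,
`Knot.Schubert1949_normalPosition_regular` through
`exists_isConnectedSum_isConcordant_of_normalPosition_regular`). Fox–Milnor (1966), §1;
Livingston (2005), Thm. 2.2. [cite: FoxMilnor1966, §1] -/
theorem exists_isConnectedSum_isConcordant_of_rebuilt (hR : Schubert1949_normalPosition_rebuilt) :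
    exists_isConnectedSum_isConcordant :=
  exists_isConnectedSum_isConcordant_of_normalPosition_regular
    (Schubert1949_normalPosition_regular_of_rebuilt BandData.isIsotopic_of_band_eq_of_isRegular_holds hR)

end Knot

end Literature.Topology.FourManifolds
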